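import Summits.QuantumFields.YangMills.Theorems.ColdStartUniversalityLatticeLangevinConjugationGenerator
import Summits.QuantumFields.YangMills.Theorems.ColdStartUniversalityLatticeLangevinZeroCarre
import HarnessLib

/-!
# Route `ColdStartUniversality` (fixed-cut-off SZZ dynamics; conjugation calculus, file 5):
# ★★ THE PATHWISE CONJUGATION IDENTITY FOR TWO SZZ SOLUTIONS DRIVEN BY THE SAME NOISE

Helper file (seat `ym-line-csu-p1`, g23).  MAIN THEOREM (`conjProduct_pair_eq_add_integral`): for two regular solution
families `U¹` (coupling `β₁ = β true`) and `U²` (coupling `β₂ = β false`) of the SU(2) lattice Langevin (Shen–Zhu–Zhu)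
dynamics on `(ℤ/L)³`, on one probability space and driven by ONE flat Brownian motion, started at `x`, `y`: almost
surely, for ALL `t ≥ 0`, every link `e` and entry `(i,j)`,

  `((ρU²_e(t))ᴴ ρU¹_e(t))_{ij} = ((ρy_e)ᴴ ρx_e)_{ij} + ∫₀ᵗ ((ρU²_e)ᴴ (D_{β₁}(U¹)_e − D_{β₂}(U²)_e) ρU¹_e)(r)_{ij} dr`,

`D_β(U)_e = driftLie β (ρU) e ∈ 𝔰𝔲(2)` the Lie-algebra drift.  The NOISE HAS CANCELLED: `t ↦ (ρU²_e)ᴴρU¹_e` is a `C¹`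
path (no martingale part, no Itô correction).  Two readings:

* `β₂ = 0` (DOSS–SUSSMANN ON THE GROUP): `U²` is the free left-invariant Brownian motion `B` on `SU(2)^E` and
  `V = Bᴴ U¹` solves the RANDOM ODE `V̇_e = Ad_{B_e⁻¹}(D_{β₁}(BV)_e) V_e` — every SZZ solution is the free Brownian motion
  composed with a `C¹` random rotation; this is the door to `x ↦ U^x_t(ω)` smooth (flow of a smooth ODE with
  deterministic derivative bounds), hence to `C^k`-smoothing of the SZZ semigroup and Bakry–Émery `Γ₂` arguments at
  fixed cut-off (csu-p1 g22 memo §3(c): the «XL-infra wall»);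
* `β₁ = β₂` (SYNCHRONOUS COUPLING): two solutions of the same equation from `x, y` differ by a `C¹` conjugation with
  speed `‖D(U^x) − D(U^y)‖` — pathwise Grönwall (sibling file `…SynchronousCoupling`).

Proof: `dynkin_conjProduct_pair` (Dynkin for `F = Re/Im((ρU²)ᴴρU¹)_{ij}` with value `G`, and for `F²` with value `2FG`:
zero carré du champ) + the abstract `L²` lemma `ae_forall_eq_add_integral_of_zero_carre`.  Also here:
`driftLie_matrixConfig_eq` (`D = (b − C_𝔤 Q_e) Q_eᴴ` on the group), `continuous_driftLie_matrixConfig`, and the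
uniform bound `exists_bound_conj_generator`.  THEOREMS ONLY, no sorry.  HONEST FRAMING: fixed-cut-off stochastic
calculus (any `β`, any `L`); nothing K-uniform; no crux, rung or summit statement is proved; the Yang–Mills mass gap is
NOT proved.
-/

set_option autoImplicit false

noncomputable section

namespace Summit.QuantumFields.YangMills.Theorems.ColdStartUniversality

open MeasureTheory ProbabilityTheory Finset Filter
open scoped NNReal Matrix ComplexConjugate Topology
open Literature.Probability.Process Literature.MathematicalPhysics.QuantumFieldTheory
open Literature.MathematicalPhysics.QuantumLattice (fundamentalRep fundamentalLatticeRep continuous_fundamentalRep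
  fundamentalRep_mem_unitaryGroup)

variable {L : ℕ} [NeZero L]

/-! ## The Lie-algebra drift on the group: formula, continuity, bounds -/

omit [NeZero L] in
/-- On the group, the Lie-algebra drift is recovered from the full drift: `D_β(U)_e = (b_e(ρU) − C_𝔤 ρU_e) (ρU_e)ᴴ`
(`b = (D + C_𝔤) Q_e`, `Q_e Q_eᴴ = 1`). [folklore] -/
theorem driftLie_matrixConfig_eq (β : ℝ) (V : GaugeConfig 3 L (Matrix.specialUnitaryGroup (Fin 2) ℂ)) (e : Edge 3 L) :
    (fundamentalLatticeRep 2).driftLie β (matrixConfig (fundamentalLatticeRep 2).ρ V) e =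
      ((latticeLangevinDynamics (fundamentalLatticeRep 2) β).drift (matrixConfig (fundamentalLatticeRep 2).ρ V) e -
        (fundamentalLatticeRep 2).casimir * ((fundamentalLatticeRep 2).ρ (V e))) *
      (((fundamentalLatticeRep 2).ρ (V e)))ᴴ := by
  have hu : ((fundamentalLatticeRep 2).ρ (V e)) *
      (((fundamentalLatticeRep 2).ρ (V e)))ᴴ = 1 := by
    rw [← Matrix.star_eq_conjTranspose]
    exact Matrix.mem_unitaryGroup_iff.1 ((fundamentalLatticeRep 2).mem_unitary (V e))
  rw [latticeLangevinDynamics_drift]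
  simp only [matrixConfig, Matrix.add_mul, add_sub_cancel_right, Matrix.mul_assoc, hu, Matrix.mul_one]

/-- **The Lie-algebra drift is continuous on the group.** [folklore] -/
theorem continuous_driftLie_matrixConfig (β : ℝ) (e : Edge 3 L) :
    Continuous fun V : GaugeConfig 3 L (Matrix.specialUnitaryGroup (Fin 2) ℂ) =>
      (fundamentalLatticeRep 2).driftLie β (matrixConfig (fundamentalLatticeRep 2).ρ V) e := by
  have hQ : Continuous fun V : GaugeConfig 3 L (Matrix.specialUnitaryGroup (Fin 2) ℂ) =>
      ((fundamentalLatticeRep 2).ρ (V e)) :=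
    (fundamentalLatticeRep 2).continuous.comp (continuous_apply e)
  have hd : Continuous fun V : GaugeConfig 3 L (Matrix.specialUnitaryGroup (Fin 2) ℂ) =>
      (latticeLangevinDynamics (fundamentalLatticeRep 2) β).drift (matrixConfig (fundamentalLatticeRep 2).ρ V) e :=
    continuous_drift_matrixConfig (L := L) β e
  have h := (hd.sub ((continuous_const (y := (fundamentalLatticeRep 2).casimir)).matrix_mul hQ)).matrix_mul
    hQ.matrix_conjTranspose
  refine h.congr fun V => ?_
  rw [driftLie_matrixConfig_eq]
  rfl

/-- **Uniform bound for the conjugated generator value**: there is `C` with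
`|Re/Im ((ρV₂_e)ᴴ (D_{β₁}(V₁)_e − D_{β₂}(V₂)_e) ρV₁_e)_{ij}| ≤ C` for all configurations (continuity on the compact
`SU(2)^E × SU(2)^E`). [folklore] -/
theorem exists_bound_conj_generator (β₁ β₂ : ℝ) :
    ∃ C : ℝ, ∀ (V₁ V₂ : GaugeConfig 3 L (Matrix.specialUnitaryGroup (Fin 2) ℂ)) (e : Edge 3 L)
      (i j : Fin (fundamentalLatticeRep 2).N) (c : Bool),
      |(fun z : ℂ => if c then z.im else z.re)
        (((((fundamentalLatticeRep 2).ρ (V₂ e)))ᴴ *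
          ((fundamentalLatticeRep 2).driftLie β₁ (matrixConfig (fundamentalLatticeRep 2).ρ V₁) e -
            (fundamentalLatticeRep 2).driftLie β₂ (matrixConfig (fundamentalLatticeRep 2).ρ V₂) e) *
          ((fundamentalLatticeRep 2).ρ (V₁ e))) i j)| ≤ C := by
  -- the complex-valued entry is a continuous function on a compact space, hence bounded
  have hcont : ∀ (e : Edge 3 L) (i j : Fin (fundamentalLatticeRep 2).N), Continuous fun p : GaugeConfig 3 L (Matrix.specialUnitaryGroup (Fin 2) ℂ) ×
      GaugeConfig 3 L (Matrix.specialUnitaryGroup (Fin 2) ℂ) =>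
      ((((fundamentalLatticeRep 2).ρ (p.2 e)))ᴴ *
        ((fundamentalLatticeRep 2).driftLie β₁ (matrixConfig (fundamentalLatticeRep 2).ρ p.1) e -
          (fundamentalLatticeRep 2).driftLie β₂ (matrixConfig (fundamentalLatticeRep 2).ρ p.2) e) *
        ((fundamentalLatticeRep 2).ρ (p.1 e))) i j := by
    intro e i j
    have h1 : Continuous fun p : GaugeConfig 3 L (Matrix.specialUnitaryGroup (Fin 2) ℂ) ×
        GaugeConfig 3 L (Matrix.specialUnitaryGroup (Fin 2) ℂ) => ((fundamentalLatticeRep 2).ρ (p.1 e)) :=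
      (fundamentalLatticeRep 2).continuous.comp ((continuous_apply e).comp continuous_fst)
    have h2 : Continuous fun p : GaugeConfig 3 L (Matrix.specialUnitaryGroup (Fin 2) ℂ) ×
        GaugeConfig 3 L (Matrix.specialUnitaryGroup (Fin 2) ℂ) => ((fundamentalLatticeRep 2).ρ (p.2 e)) :=
      (fundamentalLatticeRep 2).continuous.comp ((continuous_apply e).comp continuous_snd)
    have hD : Continuous fun p : GaugeConfig 3 L (Matrix.specialUnitaryGroup (Fin 2) ℂ) ×
        GaugeConfig 3 L (Matrix.specialUnitaryGroup (Fin 2) ℂ) =>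
        (fundamentalLatticeRep 2).driftLie β₁ (matrixConfig (fundamentalLatticeRep 2).ρ p.1) e -
          (fundamentalLatticeRep 2).driftLie β₂ (matrixConfig (fundamentalLatticeRep 2).ρ p.2) e :=
      ((continuous_driftLie_matrixConfig β₁ e).comp continuous_fst).sub
        ((continuous_driftLie_matrixConfig β₂ e).comp continuous_snd)
    exact (continuous_apply j).comp ((continuous_apply i).comp ((h2.matrix_conjTranspose.matrix_mul hD).matrix_mul h1))
  have hbd : ∀ (e : Edge 3 L) (i j : Fin (fundamentalLatticeRep 2).N), ∃ C, ∀ p : GaugeConfig 3 L (Matrix.specialUnitaryGroup (Fin 2) ℂ) ×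
      GaugeConfig 3 L (Matrix.specialUnitaryGroup (Fin 2) ℂ),
      ‖((((fundamentalLatticeRep 2).ρ (p.2 e)))ᴴ *
        ((fundamentalLatticeRep 2).driftLie β₁ (matrixConfig (fundamentalLatticeRep 2).ρ p.1) e -
          (fundamentalLatticeRep 2).driftLie β₂ (matrixConfig (fundamentalLatticeRep 2).ρ p.2) e) *
        ((fundamentalLatticeRep 2).ρ (p.1 e))) i j‖ ≤ C := by
    intro e i j
    obtain ⟨C, hC⟩ := (isCompact_univ.image (hcont e i j).norm).isBounded.subset_closedBall_lt 0 0 |>.imp fun C h => h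
    refine ⟨C, fun p => ?_⟩
    have hmem := hC.2 (Set.mem_image_of_mem _ (Set.mem_univ p))
    rw [Metric.mem_closedBall, dist_zero_right, Real.norm_eq_abs, abs_of_nonneg (norm_nonneg _)] at hmem
    exact hmem
  choose Cb hCb using hbd
  refine ⟨∑ e, ∑ i, ∑ j, |Cb e i j|, fun V₁ V₂ e i j c => ?_⟩
  have h1 : |Cb e i j| ≤ ∑ e, ∑ i, ∑ j, |Cb e i j| := by
    have a := single_le_sum (f := fun j => |Cb e i j|) (fun _ _ => abs_nonneg _) (mem_univ j)
    have b := single_le_sum (f := fun i => ∑ j, |Cb e i j|) (fun _ _ => sum_nonneg fun _ _ => abs_nonneg _) (mem_univ i)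
    have c' := single_le_sum (f := fun e => ∑ i, ∑ j, |Cb e i j|)
      (fun _ _ => sum_nonneg fun _ _ => sum_nonneg fun _ _ => abs_nonneg _) (mem_univ e)
    exact a.trans (b.trans c')
  have hz := hCb e i j (V₁, V₂)
  have hreIm : ∀ z : ℂ, |(fun z : ℂ => if c then z.im else z.re) z| ≤ ‖z‖ := fun z => by
    cases c
    · simpa using Complex.abs_re_le_norm z
    · simpa using Complex.abs_im_le_norm z
  exact ((hreIm _).trans hz).trans ((le_abs_self _).trans h1)

/-! ## The pathwise conjugation identity -/

/-- ★★ **The pathwise conjugation identity (real and imaginary parts).**  For two regular SZZ solution families driven by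
the same flat noise, every link `e`, entry `(i,j)` and `c` (real/imaginary part): almost surely, for ALL `t`,
`Re/Im((ρU²_e(t))ᴴ ρU¹_e(t))_{ij} = Re/Im((ρy_e)ᴴ ρx_e)_{ij} + ∫₀ᵗ Re/Im((ρU²_e)ᴴ (D₁ − D₂) ρU¹_e)(r)_{ij} dr`
(`U² = U false` from `y = x false`, `U¹ = U true` from `x true`). [folklore] -/
theorem reIm_conjProduct_pair_eq_add_integral (L : ℕ) [NeZero L] (β : Bool → ℝ) {Ω : Type} [MeasurableSpace Ω]
    {P : Measure Ω} [IsProbabilityMeasure P] {W : ℝ≥0 → Ω → (Edge 3 L × NoiseIdx 2 → ℝ)} (hW : IsFlatBrownian W P)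
    (U : Bool → GaugeConfig 3 L (Matrix.specialUnitaryGroup (Fin 2) ℂ) → ℝ≥0 → Ω →
      GaugeConfig 3 L (Matrix.specialUnitaryGroup (Fin 2) ℂ))
    (hU : ∀ s x, (∀ ω, U s x 0 ω = x) ∧
      (latticeLangevinDynamics (fundamentalLatticeRep 2) (β s)).IsSolution (fundamentalRep (Fin 2))
        hW.natFiltration P W (U s x))
    (hUm : ∀ (s : Bool) (i : ℝ≥0), Measurable[@Prod.instMeasurableSpace (Set.Iic i)
        (GaugeConfig 3 L (Matrix.specialUnitaryGroup (Fin 2) ℂ) × Ω) inferInstance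
        (@Prod.instMeasurableSpace (GaugeConfig 3 L (Matrix.specialUnitaryGroup (Fin 2) ℂ)) Ω inferInstance
          (hW.natFiltration i))]
      (fun q : Set.Iic i × (GaugeConfig 3 L (Matrix.specialUnitaryGroup (Fin 2) ℂ) × Ω) => U s q.2.1 q.1 q.2.2))
    (x : Bool → GaugeConfig 3 L (Matrix.specialUnitaryGroup (Fin 2) ℂ)) (e : Edge 3 L) (i j : Fin (fundamentalLatticeRep 2).N) (c : Bool) :
    ∀ᵐ ω ∂P, ∀ t : ℝ≥0,
      (fun z : ℂ => if c then z.im else z.re)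
        (((((fundamentalLatticeRep 2).ρ (U false (x false) t ω e)))ᴴ *
          ((fundamentalLatticeRep 2).ρ (U true (x true) t ω e))) i j) =
      (fun z : ℂ => if c then z.im else z.re)
        (((((fundamentalLatticeRep 2).ρ (x false e)))ᴴ *
          ((fundamentalLatticeRep 2).ρ (x true e))) i j) +
      ∫ r in Set.Ioc (0 : ℝ) t, (fun z : ℂ => if c then z.im else z.re)
        (((((fundamentalLatticeRep 2).ρ (U false (x false) r.toNNReal ω e)))ᴴ *
          ((fundamentalLatticeRep 2).driftLie (β true)
              (matrixConfig (fundamentalLatticeRep 2).ρ (U true (x true) r.toNNReal ω)) e -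
            (fundamentalLatticeRep 2).driftLie (β false)
              (matrixConfig (fundamentalLatticeRep 2).ρ (U false (x false) r.toNNReal ω)) e) *
          ((fundamentalLatticeRep 2).ρ (U true (x true) r.toNNReal ω e))) i j) := by
  classical
  haveI := secondCountableTopology_su2
  haveI := borelSpace_config L
  -- the two processes
  set F : ℝ≥0 → Ω → ℝ := fun r ω => (fun z : ℂ => if c then z.im else z.re)
    (((((fundamentalLatticeRep 2).ρ (U false (x false) r ω e)))ᴴ *
      ((fundamentalLatticeRep 2).ρ (U true (x true) r ω e))) i j) with hF
  set G : ℝ≥0 → Ω → ℝ := fun r ω => (fun z : ℂ => if c then z.im else z.re)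
    (((((fundamentalLatticeRep 2).ρ (U false (x false) r ω e)))ᴴ *
      ((fundamentalLatticeRep 2).driftLie (β true) (matrixConfig (fundamentalLatticeRep 2).ρ (U true (x true) r ω)) e -
        (fundamentalLatticeRep 2).driftLie (β false) (matrixConfig (fundamentalLatticeRep 2).ρ (U false (x false) r ω)) e) *
      ((fundamentalLatticeRep 2).ρ (U true (x true) r ω e))) i j) with hG
  -- the observables as continuous functions of the pair of configurations
  let φF : GaugeConfig 3 L (Matrix.specialUnitaryGroup (Fin 2) ℂ) → GaugeConfig 3 L (Matrix.specialUnitaryGroup (Fin 2) ℂ) →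
      ℝ := fun V₂ V₁ => (fun z : ℂ => if c then z.im else z.re)
    (((((fundamentalLatticeRep 2).ρ (V₂ e)))ᴴ *
      ((fundamentalLatticeRep 2).ρ (V₁ e))) i j)
  let φG : GaugeConfig 3 L (Matrix.specialUnitaryGroup (Fin 2) ℂ) → GaugeConfig 3 L (Matrix.specialUnitaryGroup (Fin 2) ℂ) →
      ℝ := fun V₂ V₁ => (fun z : ℂ => if c then z.im else z.re)
    (((((fundamentalLatticeRep 2).ρ (V₂ e)))ᴴ *
      ((fundamentalLatticeRep 2).driftLie (β true) (matrixConfig (fundamentalLatticeRep 2).ρ V₁) e -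
        (fundamentalLatticeRep 2).driftLie (β false) (matrixConfig (fundamentalLatticeRep 2).ρ V₂) e) *
      ((fundamentalLatticeRep 2).ρ (V₁ e))) i j)
  have hreIm_cont : Continuous (fun z : ℂ => if c then z.im else z.re) := by
    cases c
    · exact Complex.continuous_re
    · exact Complex.continuous_im
  have hQ1 : Continuous fun p : GaugeConfig 3 L (Matrix.specialUnitaryGroup (Fin 2) ℂ) ×
      GaugeConfig 3 L (Matrix.specialUnitaryGroup (Fin 2) ℂ) => ((fundamentalLatticeRep 2).ρ (p.2 e)) :=
    (fundamentalLatticeRep 2).continuous.comp ((continuous_apply e).comp continuous_snd)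
  have hQ2 : Continuous fun p : GaugeConfig 3 L (Matrix.specialUnitaryGroup (Fin 2) ℂ) ×
      GaugeConfig 3 L (Matrix.specialUnitaryGroup (Fin 2) ℂ) => ((fundamentalLatticeRep 2).ρ (p.1 e)) :=
    (fundamentalLatticeRep 2).continuous.comp ((continuous_apply e).comp continuous_fst)
  have hφF : Continuous fun p : GaugeConfig 3 L (Matrix.specialUnitaryGroup (Fin 2) ℂ) ×
      GaugeConfig 3 L (Matrix.specialUnitaryGroup (Fin 2) ℂ) => φF p.1 p.2 :=
    hreIm_cont.comp ((continuous_apply j).comp ((continuous_apply i).comp (hQ2.matrix_conjTranspose.matrix_mul hQ1)))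
  have hφG : Continuous fun p : GaugeConfig 3 L (Matrix.specialUnitaryGroup (Fin 2) ℂ) ×
      GaugeConfig 3 L (Matrix.specialUnitaryGroup (Fin 2) ℂ) => φG p.1 p.2 := by
    have hD : Continuous fun p : GaugeConfig 3 L (Matrix.specialUnitaryGroup (Fin 2) ℂ) ×
        GaugeConfig 3 L (Matrix.specialUnitaryGroup (Fin 2) ℂ) =>
        (fundamentalLatticeRep 2).driftLie (β true) (matrixConfig (fundamentalLatticeRep 2).ρ p.2) e -
          (fundamentalLatticeRep 2).driftLie (β false) (matrixConfig (fundamentalLatticeRep 2).ρ p.1) e :=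
      ((continuous_driftLie_matrixConfig (β true) e).comp continuous_snd).sub
        ((continuous_driftLie_matrixConfig (β false) e).comp continuous_fst)
    exact hreIm_cont.comp ((continuous_apply j).comp ((continuous_apply i).comp
      ((hQ2.matrix_conjTranspose.matrix_mul hD).matrix_mul hQ1)))
  have hFφ : ∀ r ω, F r ω = φF (U false (x false) r ω) (U true (x true) r ω) := fun r ω => rfl
  have hGφ : ∀ r ω, G r ω = φG (U false (x false) r ω) (U true (x true) r ω) := fun r ω => rfl
  -- bounds
  have hFb : ∀ r ω, |F r ω| ≤ 1 := by
    intro r ω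
    have hu : ((((fundamentalLatticeRep 2).ρ (U false (x false) r ω e)))ᴴ *
        ((fundamentalLatticeRep 2).ρ (U true (x true) r ω e))) ∈ Matrix.unitaryGroup (Fin (fundamentalLatticeRep 2).N) ℂ := by
      refine Submonoid.mul_mem _ ?_ ((fundamentalLatticeRep 2).mem_unitary _)
      rw [← Matrix.star_eq_conjTranspose]
      exact Unitary.star_mem ((fundamentalLatticeRep 2).mem_unitary _)
    have h1 := entry_norm_bound_of_unitary hu i j
    cases c
    · exact (Complex.abs_re_le_norm _).trans h1
    · exact (Complex.abs_im_le_norm _).trans h1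
  obtain ⟨CG, hCG⟩ := exists_bound_conj_generator (L := L) (β true) (β false)
  have hGb : ∀ r ω, |G r ω| ≤ CG := fun r ω => hCG _ _ e i j c
  -- adaptedness and joint measurability
  have hsol : ∀ s, (latticeLangevinDynamics (fundamentalLatticeRep 2) (β s)).IsSolution (fundamentalRep (Fin 2))
      hW.natFiltration P W (U s (x s)) := fun s => (hU s (x s)).2
  have hpair_ad : ∀ r : ℝ≥0, Measurable[hW.natFiltration r] fun ω => (U false (x false) r ω, U true (x true) r ω) :=
    fun r => ((hsol false).adapted r).prodMk ((hsol true).adapted r)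
  have hFad : ∀ r, StronglyMeasurable[hW.natFiltration r] (F r) := fun r =>
    (hφF.measurable.comp (hpair_ad r)).stronglyMeasurable
  have hGad : ∀ r, StronglyMeasurable[hW.natFiltration r] (G r) := fun r =>
    (hφG.measurable.comp (hpair_ad r)).stronglyMeasurable
  have hFm : Measurable fun p : Ω × ℝ => F p.2.toNNReal p.1 :=
    measurable_comp_flow₂_toNNReal (hUm false) (hUm true) (x false) (x true) hφF.measurable
  have hGm : Measurable fun p : Ω × ℝ => G p.2.toNNReal p.1 :=
    measurable_comp_flow₂_toNNReal (hUm false) (hUm true) (x false) (x true) hφG.measurable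
  -- path continuity
  have hFc : ∀ᵐ ω ∂P, Continuous fun r : ℝ≥0 => F r ω := by
    filter_upwards [(hsol false).continuous, (hsol true).continuous] with ω h2 h1
    have hcomp : (fun r : ℝ≥0 => F r ω) =
        (fun p : GaugeConfig 3 L (Matrix.specialUnitaryGroup (Fin 2) ℂ) ×
          GaugeConfig 3 L (Matrix.specialUnitaryGroup (Fin 2) ℂ) => φF p.1 p.2) ∘
        fun r : ℝ≥0 => (U false (x false) r ω, U true (x true) r ω) := by
      funext r; exact hFφ r ω
    rw [hcomp]
    exact hφF.comp (h2.prodMk h1)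
  have hGc : ∀ᵐ ω ∂P, Continuous fun r : ℝ => G r.toNNReal ω := by
    filter_upwards [(hsol false).continuous, (hsol true).continuous] with ω h2 h1
    have hcomp : (fun r : ℝ => G r.toNNReal ω) =
        (fun p : GaugeConfig 3 L (Matrix.specialUnitaryGroup (Fin 2) ℂ) ×
          GaugeConfig 3 L (Matrix.specialUnitaryGroup (Fin 2) ℂ) => φG p.1 p.2) ∘
        fun r : ℝ => (U false (x false) r.toNNReal ω, U true (x true) r.toNNReal ω) := by
      funext r; exact hGφ r.toNNReal ω
    rw [hcomp]
    exact hφG.comp ((h2.comp continuous_real_toNNReal).prodMk (h1.comp continuous_real_toNNReal))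
  -- the Dynkin identities
  have hD1 : ∀ (s t : ℝ≥0), s ≤ t → ∀ (Z : Ω → ℝ) (C : ℝ), StronglyMeasurable[hW.natFiltration s] Z →
      (∀ ω, |Z ω| ≤ C) →
      ∫ ω, Z ω * (F t ω - F s ω) ∂P = ∫ ω, Z ω * (∫ r in Set.Ioc (s : ℝ) t, G r.toNNReal ω) ∂P :=
    fun s t hst Z C hZ hC => (dynkin_conjProduct_pair L β hW U hU hUm x e i j c hst hZ hC).1
  have hD2 : ∀ t : ℝ≥0, ∫ ω, (F t ω ^ 2 - F 0 ω ^ 2) ∂P =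
      ∫ ω, (∫ r in Set.Ioc (0 : ℝ) t, 2 * F r.toNNReal ω * G r.toNNReal ω) ∂P := by
    intro t
    have h := (dynkin_conjProduct_pair L β hW U hU hUm x e i j c (s₀ := 0) (t := t) bot_le (Z := fun _ => (1 : ℝ))
      (@stronglyMeasurable_const _ _ (hW.natFiltration 0) _ _) (C := 1) (fun _ => by simp)).2
    simpa only [one_mul, NNReal.coe_zero] using h
  have h := ae_forall_eq_add_integral_of_zero_carre hFb hGb hFad hGad hFm hGm hFc hGc hD1 hD2
  filter_upwards [h] with ω hω t
  have h0 : F 0 ω = (fun z : ℂ => if c then z.im else z.re)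
      (((((fundamentalLatticeRep 2).ρ (x false e)))ᴴ *
        ((fundamentalLatticeRep 2).ρ (x true e))) i j) := by
    simp only [hF, (hU false (x false)).1 ω, (hU true (x true)).1 ω]
  have h1 := hω t
  rw [h0] at h1
  exact h1

/-! ## Doss–Sussmann on the group: conjugation by the free Brownian motion -/

omit [NeZero L] in
/-- At zero coupling the Lie-algebra drift vanishes. [folklore] -/
theorem driftLie_zero (Q : MatrixConfig 3 L (fundamentalLatticeRep 2).N) (e : Edge 3 L) :
    (fundamentalLatticeRep 2).driftLie 0 Q e = 0 := by
  rw [LatticeRep.driftLie, zero_smul]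

/-- ★★ **Doss–Sussmann representation on `SU(2)^E`.**  Let `B` be a regular solution family of the FREE dynamics
(`β = 0`: left-invariant Brownian motion on `SU(2)^E` with its Itô drift `C_𝔤 Q`) and `U` a regular solution family at
coupling `β`, driven by the same flat noise, started at `b` and `x`.  Then almost surely, for ALL `t`,
`Re/Im((ρB_e(t))ᴴ ρU_e(t))_{ij} = Re/Im((ρb_e)ᴴ ρx_e)_{ij} + ∫₀ᵗ Re/Im((ρB_e)ᴴ D_β(U)_e ρU_e)(r)_{ij} dr`:
`V = Bᴴ U` is a `C¹` path solving the random ODE `V̇_e = (ρB_e)ᴴ D_β(BV)_e (ρB_e) V_e` — the SZZ solution is the free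
Brownian motion composed with a `C¹` random rotation (no martingale part, no Itô correction). [folklore] -/
theorem reIm_dossSussmann_eq_add_integral (L : ℕ) [NeZero L] (β : ℝ) {Ω : Type} [MeasurableSpace Ω]
    {P : Measure Ω} [IsProbabilityMeasure P] {W : ℝ≥0 → Ω → (Edge 3 L × NoiseIdx 2 → ℝ)} (hW : IsFlatBrownian W P)
    (B U : GaugeConfig 3 L (Matrix.specialUnitaryGroup (Fin 2) ℂ) → ℝ≥0 → Ω →
      GaugeConfig 3 L (Matrix.specialUnitaryGroup (Fin 2) ℂ))
    (hB : ∀ x, (∀ ω, B x 0 ω = x) ∧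
      (latticeLangevinDynamics (fundamentalLatticeRep 2) 0).IsSolution (fundamentalRep (Fin 2)) hW.natFiltration P W (B x))
    (hBm : ∀ i : ℝ≥0, Measurable[@Prod.instMeasurableSpace (Set.Iic i)
        (GaugeConfig 3 L (Matrix.specialUnitaryGroup (Fin 2) ℂ) × Ω) inferInstance
        (@Prod.instMeasurableSpace (GaugeConfig 3 L (Matrix.specialUnitaryGroup (Fin 2) ℂ)) Ω inferInstance
          (hW.natFiltration i))]
      (fun q : Set.Iic i × (GaugeConfig 3 L (Matrix.specialUnitaryGroup (Fin 2) ℂ) × Ω) => B q.2.1 q.1 q.2.2))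
    (hU : ∀ x, (∀ ω, U x 0 ω = x) ∧
      (latticeLangevinDynamics (fundamentalLatticeRep 2) β).IsSolution (fundamentalRep (Fin 2)) hW.natFiltration P W (U x))
    (hUm : ∀ i : ℝ≥0, Measurable[@Prod.instMeasurableSpace (Set.Iic i)
        (GaugeConfig 3 L (Matrix.specialUnitaryGroup (Fin 2) ℂ) × Ω) inferInstance
        (@Prod.instMeasurableSpace (GaugeConfig 3 L (Matrix.specialUnitaryGroup (Fin 2) ℂ)) Ω inferInstance
          (hW.natFiltration i))]
      (fun q : Set.Iic i × (GaugeConfig 3 L (Matrix.specialUnitaryGroup (Fin 2) ℂ) × Ω) => U q.2.1 q.1 q.2.2))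
    (b x : GaugeConfig 3 L (Matrix.specialUnitaryGroup (Fin 2) ℂ)) (e : Edge 3 L)
    (i j : Fin (fundamentalLatticeRep 2).N) (c : Bool) :
    ∀ᵐ ω ∂P, ∀ t : ℝ≥0,
      (fun z : ℂ => if c then z.im else z.re)
        ((((fundamentalLatticeRep 2).ρ (B b t ω e))ᴴ * (fundamentalLatticeRep 2).ρ (U x t ω e)) i j) =
      (fun z : ℂ => if c then z.im else z.re)
        ((((fundamentalLatticeRep 2).ρ (b e))ᴴ * (fundamentalLatticeRep 2).ρ (x e)) i j) +
      ∫ r in Set.Ioc (0 : ℝ) t, (fun z : ℂ => if c then z.im else z.re)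
        ((((fundamentalLatticeRep 2).ρ (B b r.toNNReal ω e))ᴴ *
          (fundamentalLatticeRep 2).driftLie β (matrixConfig (fundamentalLatticeRep 2).ρ (U x r.toNNReal ω)) e *
          (fundamentalLatticeRep 2).ρ (U x r.toNNReal ω e)) i j) := by
  have h := reIm_conjProduct_pair_eq_add_integral L (fun s => cond s β 0) hW (fun s => cond s U B)
    (fun s => by cases s <;> simpa using (by first | exact hB | exact hU))
    (fun s => by cases s <;> simpa using (by first | exact hBm | exact hUm)) (fun s => cond s x b) e i j c
  filter_upwards [h] with ω hω t
  have h1 := hω t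
  simp only [cond_true, cond_false, driftLie_zero, sub_zero] at h1
  exact h1

end Summit.QuantumFields.YangMills.Theorems.ColdStartUniversality

end
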